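import Summits.RiemannHypothesis.RiemannHypothesis.Theorems.Splittings.BombieriTruncSynthesisRows
import Literature.NumberTheory.DiophantineGeometry.NamedHypotheses
import Literature.NumberTheory.LFunctions.RHWave0
import Literature.NumberTheory.LFunctions.WeilZeroSum
import Literature.NumberTheory.LFunctions.VinogradovKorobovFarZeros
import HarnessLib

/-!
# Splittings — x-wuc GEN-11: `SplitXWucK1R.lean` — K1′(ℝ) AT THE STAKE, the dependency-closed VERBATIM EXTRACT

Cell rh-split, seat rh-split-x-wuc g11 (brief sha16 f79c5f09d8bcb036), card `run/shared/lean/pub/rh-split/cards/SPLIT-x-wuc.md` §17.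
The chain of record `SplitXWucG11l.lean` ++ `kernel_g11/G11m_addendum.lean` ++ `kernel_g11/G11n_addendum.lean` exceeds the farm's
request size (512 KiB), so this file is the MECHANICAL EXTRACT (script `kernel_g11/extract_k1r.py`): every structural line of the
chain (imports, namespaces, sections, `open`, `variable`, options) and exactly the declaration units (with their docstrings), VERBATIM
and in order, that lie in the reference closure of the targets `kCertLROn_realVal_stake`, `kCertFarResidual_stake`,
`kCertLROn_realVal_of_le`, `DSLine.certBodyR_of_local`.  Main results: `DSLine.certBodyR_of_local` (the localised two-lobe certificate,
blueprint §L) and **`kCertLROn_realVal_stake : KCertLROn RealVal 400 (3/2) (21/500)`** — the REAL-VALUED class of the node of record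
K-CERT′ = `KCertLR 400 (3/2) θ` at the stake `θ = 0.042`, for every density `D ≥ 1`.
HONEST LABEL: «SPLITTING SEARCH over kernel-typed RH-EQUIVALENCES; a splitting A ∧ B ⟹ RH is CONDITIONAL bookkeeping
unless A and B are both proved; nothing here bears on the truth of RH.»  K-CERT′ itself (complex `f`) stays an OPEN cell node.
MECHANICAL CARVE (rh-split typer-4 g0, RULING #330): part 1/14 of the byte-identical extract `SplitXWucK1R.lean`
sha16 70c8eb2af2868881 (x-wuc g11; referee ref g10 PASS 22:59:46Z); cuts only between declaration units, open namespaces/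
sections closed at each cut and re-opened with their `open`/`variable` context in the next part; the trailing `#print axioms`
guard block is dropped (the gate verifies axioms); four one-token lint repairs are listed in part A's STATUS bytes line.
-/
set_option linter.dupNamespace false
noncomputable section
open scoped Classical ComplexConjugate
open Set Filter Topology Complex MeasureTheory
namespace Summit.RiemannHypothesis.RiemannHypothesis.Theorems.Splittings.XWucG8
open Literature.NumberTheory.LFunctions Literature.NumberTheory.LFunctions.Bombieri2000
open Summit.RiemannHypothesis.RiemannHypothesis.Theses.RuelleBand
open Summit.RiemannHypothesis.RiemannHypothesis.Theorems.Splittings.BombieriTruncEigen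
open Summit.RiemannHypothesis.RiemannHypothesis.Theorems.Splittings.BombieriFozNoDep
open Summit.RiemannHypothesis.RiemannHypothesis.Theorems.Splittings.BombieriTruncGram
open Summit.RiemannHypothesis.RiemannHypothesis.Theorems.Splittings.BombieriTruncPairing
open Summit.RiemannHypothesis.RiemannHypothesis.Theorems.Splittings.BombieriTruncScreening
open Summit.RiemannHypothesis.RiemannHypothesis.Theorems.Splittings.BombieriTruncBandGap
open Summit.RiemannHypothesis.RiemannHypothesis.Theorems.Splittings.BombieriTruncMultiplicity
open Summit.RiemannHypothesis.RiemannHypothesis.Theorems.Splittings.BombieriTruncEventualStrip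
open Summit.RiemannHypothesis.RiemannHypothesis.Theorems.Splittings.BombieriTruncExactness
open Summit.RiemannHypothesis.RiemannHypothesis.Theorems.Splittings.BombieriTruncClump
open Summit.RiemannHypothesis.RiemannHypothesis.Theorems.Splittings.BombieriTruncOffLineSparse
open Summit.RiemannHypothesis.RiemannHypothesis.Theorems.Splittings.BombieriTruncSynthesis
open Summit.RiemannHypothesis.RiemannHypothesis.Theorems.Splittings.BombieriTruncSynthesisScreening
open Summit.RiemannHypothesis.RiemannHypothesis.Theorems.Splittings.BombieriTruncSynthesisRows
variable {N : ℕ}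
open Literature.NumberTheory.DiophantineGeometry (RiemannHypothesisUpTo)
/-- `Φ(κ) = ∫_{−1}^{1} (2 sinh κu)² du = 4·(sinh(2κ)/(2κ) − 1)` — the energy of the off-line profile (`Φ ≤ Φ(½) = 0.7008…`). -/
def Phi (κ : ℝ) : ℝ := 4 * (Real.sinh (2 * κ) / (2 * κ) - 1)

open scoped Classical in
/-- KEY of a slot: its zero folded to `Re ≥ ½` (`ρ ↦ ρ` on or right of the line, `ρ ↦ 1 − ρ̄` left of it); a class pair shares one key. -/
noncomputable def key (i : truncIdx N) : ℂ :=
  if 1 / 2 ≤ (i : ZeroIdx).val.re then (i : ZeroIdx).val else 1 - conj (i : ZeroIdx).val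

end Summit.RiemannHypothesis.RiemannHypothesis.Theorems.Splittings.XWucG8
namespace Summit.RiemannHypothesis.RiemannHypothesis.Theorems.Splittings.XWucG8
open scoped Classical ComplexConjugate
open Set Filter Topology Complex MeasureTheory
open Literature.NumberTheory.LFunctions Literature.NumberTheory.LFunctions.Bombieri2000
open Summit.RiemannHypothesis.RiemannHypothesis.Theses.RuelleBand
open Summit.RiemannHypothesis.RiemannHypothesis.Theorems.Splittings.BombieriTruncEigen
open Summit.RiemannHypothesis.RiemannHypothesis.Theorems.Splittings.BombieriFozNoDep
open Summit.RiemannHypothesis.RiemannHypothesis.Theorems.Splittings.BombieriTruncGram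
open Summit.RiemannHypothesis.RiemannHypothesis.Theorems.Splittings.BombieriTruncPairing
open Summit.RiemannHypothesis.RiemannHypothesis.Theorems.Splittings.BombieriTruncScreening
open Summit.RiemannHypothesis.RiemannHypothesis.Theorems.Splittings.BombieriTruncBandGap
open Summit.RiemannHypothesis.RiemannHypothesis.Theorems.Splittings.BombieriTruncMultiplicity
open Summit.RiemannHypothesis.RiemannHypothesis.Theorems.Splittings.BombieriTruncEventualStrip
open Summit.RiemannHypothesis.RiemannHypothesis.Theorems.Splittings.BombieriTruncExactness
open Summit.RiemannHypothesis.RiemannHypothesis.Theorems.Splittings.BombieriTruncClump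
open Summit.RiemannHypothesis.RiemannHypothesis.Theorems.Splittings.BombieriTruncOffLineSparse
open Summit.RiemannHypothesis.RiemannHypothesis.Theorems.Splittings.BombieriTruncSynthesis
open Summit.RiemannHypothesis.RiemannHypothesis.Theorems.Splittings.BombieriTruncSynthesisScreening
open Summit.RiemannHypothesis.RiemannHypothesis.Theorems.Splittings.BombieriTruncSynthesisRows
open Literature.NumberTheory.DiophantineGeometry (RiemannHypothesisUpTo)
/-- `Φ(κ) ≥ 0` for `κ > 0` (from `x ≤ sinh x` on `[0, ∞)`). -/
theorem Phi_nonneg_of_pos {κ : ℝ} (hκ : 0 < κ) : 0 ≤ Phi κ := by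
  unfold Phi
  have h1 : 2 * κ ≤ Real.sinh (2 * κ) := Real.self_le_sinh_iff.2 (by linarith)
  have h2 : 1 ≤ Real.sinh (2 * κ) / (2 * κ) := by
    rw [le_div_iff₀ (by linarith)]; linarith
  linarith

end Summit.RiemannHypothesis.RiemannHypothesis.Theorems.Splittings.XWucG8
namespace Summit.RiemannHypothesis.RiemannHypothesis.Theorems.Splittings.XWucG8
open scoped Classical ComplexConjugate InnerProductSpace
open Set Filter Topology Complex MeasureTheory
open Literature.NumberTheory.LFunctions Literature.NumberTheory.LFunctions.Bombieri2000
open Summit.RiemannHypothesis.RiemannHypothesis.Theses.RuelleBand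
open Summit.RiemannHypothesis.RiemannHypothesis.Theorems.Splittings.BombieriTruncEigen
open Summit.RiemannHypothesis.RiemannHypothesis.Theorems.Splittings.BombieriFozNoDep
open Summit.RiemannHypothesis.RiemannHypothesis.Theorems.Splittings.BombieriTruncGram
open Summit.RiemannHypothesis.RiemannHypothesis.Theorems.Splittings.BombieriTruncPairing
open Summit.RiemannHypothesis.RiemannHypothesis.Theorems.Splittings.BombieriTruncScreening
open Summit.RiemannHypothesis.RiemannHypothesis.Theorems.Splittings.BombieriTruncBandGap
open Summit.RiemannHypothesis.RiemannHypothesis.Theorems.Splittings.BombieriTruncMultiplicity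
open Summit.RiemannHypothesis.RiemannHypothesis.Theorems.Splittings.BombieriTruncEventualStrip
open Summit.RiemannHypothesis.RiemannHypothesis.Theorems.Splittings.BombieriTruncExactness
open Summit.RiemannHypothesis.RiemannHypothesis.Theorems.Splittings.BombieriTruncClump
open Summit.RiemannHypothesis.RiemannHypothesis.Theorems.Splittings.BombieriTruncOffLineSparse
open Summit.RiemannHypothesis.RiemannHypothesis.Theorems.Splittings.BombieriTruncSynthesis
open Summit.RiemannHypothesis.RiemannHypothesis.Theorems.Splittings.BombieriTruncSynthesisScreening
open Summit.RiemannHypothesis.RiemannHypothesis.Theorems.Splittings.BombieriTruncSynthesisRows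
open Literature.NumberTheory.DiophantineGeometry (RiemannHypothesisUpTo)
namespace KCertRidge
variable {E : Type*} [NormedAddCommGroup E] [InnerProductSpace ℂ E]
/-- The ridge functional. -/
noncomputable def J {n : ℕ} (G : E) (Φ : Fin n → E) (w : Fin n → ℝ) (b : Fin n → ℂ) : ℝ :=
  ‖G - ∑ j, b j • Φ j‖ ^ 2 + ∑ k, ‖b k‖ ^ 2 / w k

end KCertRidge
namespace KCertBridge
section LpBridges
variable {α : Type*} [MeasurableSpace α] {μ : Measure α}
/-- `‖F‖² = ∫ ‖F x‖²` for `F ∈ L²(μ; ℂ)`. -/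
theorem norm_sq_eq_integral (F : Lp ℂ 2 μ) : ‖F‖ ^ 2 = ∫ x, ‖(F : α → ℂ) x‖ ^ 2 ∂μ := by
  have h0 : RCLike.re ⟪F, F⟫_ℂ = ‖F‖ ^ 2 := inner_self_eq_norm_sq (𝕜 := ℂ) F
  rw [← h0, MeasureTheory.L2.inner_def (𝕜 := ℂ) F F]
  simp only [inner_self_eq_norm_sq_to_K, ← RCLike.ofReal_pow]
  rw [integral_ofReal, RCLike.ofReal_re]

/-- `⟪F, G⟫ = ∫ conj (F x) * G x` in `L²(μ; ℂ)`. -/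
theorem inner_eq_integral (F G : Lp ℂ 2 μ) :
    ⟪F, G⟫_ℂ = ∫ x, conj ((F : α → ℂ) x) * (G : α → ℂ) x ∂μ := by
  rw [MeasureTheory.L2.inner_def (𝕜 := ℂ) F G]
  simp only [RCLike.inner_apply']

end LpBridges
/-- A continuous `ℝ → ℂ` function is in `L²` of Lebesgue measure restricted to `[-1, 1]`. -/
theorem memLp_two_Icc_of_continuous {h : ℝ → ℂ} (hc : Continuous h) :
    MemLp h 2 (volume.restrict (Icc (-1 : ℝ) 1)) := by
  obtain ⟨C, hC⟩ := (isCompact_Icc (a := (-1 : ℝ)) (b := 1)).exists_bound_of_continuousOn hc.continuousOn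
  exact MemLp.of_bound hc.aestronglyMeasurable C
    ((ae_restrict_mem measurableSet_Icc).mono fun x hx ↦ hC x hx)

end KCertBridge
section Reduction
open KCertRidge KCertBridge
/-- The TEST-FUNCTION TRANSFORM `F_f(λ, κ) = ∫_{[-1,1]} f(u) cosh(κu) e^{iλu} du` (= `⟨f, φ_{λ,κ}⟩`). -/
def tfT (f : ℝ → ℂ) (lam κ : ℝ) : ℂ :=
  ∫ u in Icc (-1 : ℝ) 1, f u * (Real.cosh (κ * u) : ℂ) * cexp (I * (lam : ℂ) * u)

end Reduction
end Summit.RiemannHypothesis.RiemannHypothesis.Theorems.Splittings.XWucG8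
namespace Summit.RiemannHypothesis.RiemannHypothesis.Theorems.Splittings.XWucG8
open scoped Classical ComplexConjugate
open Set Filter Topology Complex MeasureTheory
/-- `KCertL` with the test functions restricted to a class `S` (same body). -/
def KCertLOn (S : Set (ℝ → ℂ)) (Lc δ θ : ℝ) : Prop :=
  ∀ ε : ℝ, 0 < ε → ∀ κ₀ : ℝ, 0 < κ₀ → κ₀ < 1 / 2 → ∀ f : ℝ → ℂ, f ∈ S → Continuous f →
    ∃ (m : ℕ) (a b t : Fin m → ℝ),
      (∀ i, -(Real.exp (2 * Real.pi) / 4) ≤ a i ∧ a i < b i ∧ b i ≤ Real.exp (2 * Real.pi) / 4 ∧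
          b i - a i ≤ Lc ∧ 0 ≤ t i) ∧
      (∀ lam κ : ℝ, 0 ≤ κ → κ < 1 / 2 →
          (∑ i ∈ Finset.univ.filter (fun i ↦ a i < lam ∧ lam ≤ b i), t i) ≤ ‖tfT f lam κ‖ ^ 2) ∧
      2 * Real.pi * θ * ‖∫ u in Icc (-1 : ℝ) 1, 2 * (Real.sinh (κ₀ * u) : ℂ) * f u‖ ^ 2 ≤
        (1 + ε) * Phi κ₀ * ∑ i, t i * (b i - a i - δ - (if a i < 0 ∧ 0 ≤ b i then δ else 0))

/-- `kCertLOn_anti` — helper of the x-wuc GEN-11 chain «K1′(ℝ) at the stake» (verbatim from the referee-passed extract `SplitXWucK1R.lean` 70c8eb2af2868881; role: see the module docstring). -/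
theorem kCertLOn_anti {S : Set (ℝ → ℂ)} {Lc δ θ θ' : ℝ} (hle : θ' ≤ θ) (h : KCertLOn S Lc δ θ) :
    KCertLOn S Lc δ θ' := by
  intro ε hε κ₀ h1 h2 f hfS hfc
  obtain ⟨m, a, b, t, hw, hc, hfin⟩ := h ε hε κ₀ h1 h2 f hfS hfc
  refine ⟨m, a, b, t, hw, hc, le_trans ?_ hfin⟩
  have : 0 ≤ 2 * Real.pi * ‖∫ u in Icc (-1 : ℝ) 1, 2 * (Real.sinh (κ₀ * u) : ℂ) * f u‖ ^ 2 := by positivity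
  nlinarith

namespace SignConeRung
/-- `chord_sinh` — helper of the x-wuc GEN-11 chain «K1′(ℝ) at the stake» (verbatim from the referee-passed extract `SplitXWucK1R.lean` 70c8eb2af2868881; role: see the module docstring). -/
theorem chord_sinh {κ v : ℝ} (hκ : 0 ≤ κ) (hv0 : 0 ≤ v) (hv1 : v ≤ 1) :
    Real.sinh (κ * v) ≤ v * Real.sinh κ := by
  have h1 := Real.hasSum_sinh (κ * v)
  have h2 := (Real.hasSum_sinh κ).mul_left v
  refine hasSum_le (fun n ↦ ?_) h1 h2
  have hvp : v ^ (2 * n + 1) ≤ v := by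
    calc v ^ (2 * n + 1) = v * v ^ (2 * n) := by ring
      _ ≤ v * 1 := by gcongr; exact pow_le_one₀ hv0 hv1
      _ = v := mul_one v
  have hκp : 0 ≤ κ ^ (2 * n + 1) := pow_nonneg hκ _
  have hfac : (0 : ℝ) < (2 * n + 1).factorial := by exact_mod_cast Nat.factorial_pos _
  have hle : (κ * v) ^ (2 * n + 1) ≤ v * κ ^ (2 * n + 1) := by
    rw [mul_pow]; nlinarith
  calc (κ * v) ^ (2 * n + 1) / ((2 * n + 1).factorial : ℝ)
        ≤ (v * κ ^ (2 * n + 1)) / ((2 * n + 1).factorial : ℝ) := by gcongr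
    _ = v * (κ ^ (2 * n + 1) / ((2 * n + 1).factorial : ℝ)) := by ring

/-- `sinh_lower` — helper of the x-wuc GEN-11 chain «K1′(ℝ) at the stake» (verbatim from the referee-passed extract `SplitXWucK1R.lean` 70c8eb2af2868881; role: see the module docstring). -/
theorem sinh_lower {y : ℝ} (hy : 0 ≤ y) : y + y ^ 3 / 6 ≤ Real.sinh y := by
  have h := sum_le_hasSum (Finset.range 2) (fun n _ ↦ by positivity) (Real.hasSum_sinh y)
  norm_num [Finset.sum_range_succ, Nat.factorial] at h
  linarith

/-- `sinh_half_lt` — helper of the x-wuc GEN-11 chain «K1′(ℝ) at the stake» (verbatim from the referee-passed extract `SplitXWucK1R.lean` 70c8eb2af2868881; role: see the module docstring). -/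
theorem sinh_half_lt : Real.sinh (1 / 2) < 0.5211 := by
  rw [Real.sinh_eq]
  have hx : Real.exp (1 / 2) * Real.exp (1 / 2) = Real.exp 1 := by rw [← Real.exp_add]; norm_num
  have hxpos := Real.exp_pos (1 / 2 : ℝ)
  have hx1 : Real.exp (1 / 2) < 1.6487213 := by nlinarith [Real.exp_one_lt_d9]
  have hy : Real.exp (-(1 / 2)) * Real.exp (1 / 2) = 1 := by rw [← Real.exp_add]; norm_num
  have hypos := Real.exp_pos (-(1 / 2) : ℝ)
  have hx2 : 0.60653 < Real.exp (-(1 / 2)) := by nlinarith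
  linarith

/-- `sinh_le_of_le_half` — helper of the x-wuc GEN-11 chain «K1′(ℝ) at the stake» (verbatim from the referee-passed extract `SplitXWucK1R.lean` 70c8eb2af2868881; role: see the module docstring). -/
theorem sinh_le_of_le_half {κ : ℝ} (hκ0 : 0 ≤ κ) (hκ : κ ≤ 1 / 2) : Real.sinh κ ≤ 2 * κ * 0.5211 := by
  have h := chord_sinh (κ := 1 / 2) (v := 2 * κ) (by norm_num) (by linarith) (by linarith)
  rw [show (1 / 2 : ℝ) * (2 * κ) = κ by ring] at h
  have := sinh_half_lt
  nlinarith

/-- `Phi_lower` — helper of the x-wuc GEN-11 chain «K1′(ℝ) at the stake» (verbatim from the referee-passed extract `SplitXWucK1R.lean` 70c8eb2af2868881; role: see the module docstring). -/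
theorem Phi_lower {κ : ℝ} (hκ : 0 < κ) : 8 / 3 * κ ^ 2 ≤ Phi κ := by
  unfold Phi
  have h := sinh_lower (y := 2 * κ) (by linarith)
  have h2 : 1 + (2 * κ) ^ 2 / 6 ≤ Real.sinh (2 * κ) / (2 * κ) := by
    rw [le_div_iff₀ (by linarith)]; nlinarith
  nlinarith

/-- `three_le_Lambda` — helper of the x-wuc GEN-11 chain «K1′(ℝ) at the stake» (verbatim from the referee-passed extract `SplitXWucK1R.lean` 70c8eb2af2868881; role: see the module docstring). -/
theorem three_le_Lambda : 3 ≤ Real.exp (2 * Real.pi) / 4 := by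
  have h := Real.sum_le_exp_of_nonneg (x := 2 * Real.pi) (by positivity) 3
  simp [Finset.sum_range_succ, Nat.factorial] at h
  nlinarith [Real.pi_gt_three]

/-- `continuous_integrand` — helper of the x-wuc GEN-11 chain «K1′(ℝ) at the stake» (verbatim from the referee-passed extract `SplitXWucK1R.lean` 70c8eb2af2868881; role: see the module docstring). -/
theorem continuous_integrand {f : ℝ → ℂ} (hfc : Continuous f) (lam κ : ℝ) :
    Continuous fun u : ℝ ↦ f u * (Real.cosh (κ * u) : ℂ) * cexp (I * (lam : ℂ) * u) := by
  fun_prop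

/-- Conjugation symmetry `F_f(-λ, κ) = conj F_f(λ, κ)` for real-valued `f`. -/
theorem tfT_neg {f : ℝ → ℂ} (hf : ∀ u ∈ Icc (-1 : ℝ) 1, (f u).im = 0) (lam κ : ℝ) :
    tfT f (-lam) κ = conj (tfT f lam κ) := by
  unfold tfT
  rw [← integral_conj]
  refine setIntegral_congr_fun measurableSet_Icc fun u hu ↦ ?_
  have hfu : conj (f u) = f u := Complex.conj_eq_iff_im.2 (hf u hu)
  simp only [map_mul, hfu, Complex.conj_ofReal, ← Complex.exp_conj, Complex.conj_I, Complex.ofReal_neg]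
  ring_nf

end SignConeRung
end Summit.RiemannHypothesis.RiemannHypothesis.Theorems.Splittings.XWucG8
namespace Summit.RiemannHypothesis.RiemannHypothesis.Theorems.Splittings.XWucG8
open scoped Classical ComplexConjugate
open Set Filter Topology Complex MeasureTheory
namespace SignConeRung
/-- Reflection `u ↦ −u` preserves the integral over `[−1,1]`. -/
theorem integral_reflect (h : ℝ → ℂ) : ∫ u in Icc (-1 : ℝ) 1, h (-u) = ∫ u in Icc (-1 : ℝ) 1, h u := by
  rw [integral_Icc_eq_integral_Ioc, integral_Icc_eq_integral_Ioc, ← intervalIntegral.integral_of_le (by norm_num),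
    ← intervalIntegral.integral_of_le (by norm_num), intervalIntegral.integral_comp_neg]
  norm_num

/-- The transform of the reflected function is the transform at `−λ`. -/
theorem tfT_reflect (f : ℝ → ℂ) (lam κ : ℝ) : tfT (fun u ↦ f (-u)) lam κ = tfT f (-lam) κ := by
  unfold tfT
  rw [← integral_reflect (fun u ↦ f u * (Real.cosh (κ * u) : ℂ) * cexp (I * ((-lam : ℝ) : ℂ) * u))]
  refine setIntegral_congr_fun measurableSet_Icc fun u _ ↦ ?_
  simp only [mul_neg, Real.cosh_neg, Complex.ofReal_neg]
  ring_nf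

/-- The pairing with the odd kernel `2 sinh(κ₀ u)` changes sign under reflection. -/
theorem pairing_reflect (f : ℝ → ℂ) (κ₀ : ℝ) :
    ∫ u in Icc (-1 : ℝ) 1, 2 * (Real.sinh (κ₀ * u) : ℂ) * f (-u) =
      -∫ u in Icc (-1 : ℝ) 1, 2 * (Real.sinh (κ₀ * u) : ℂ) * f u := by
  rw [← integral_neg, ← integral_reflect (fun u ↦ -(2 * (Real.sinh (κ₀ * u) : ℂ) * f u))]
  refine setIntegral_congr_fun measurableSet_Icc fun u _ ↦ ?_
  simp only [mul_neg, Real.sinh_neg, Complex.ofReal_neg]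
  ring

/-- The odd part `(f(u) − f(−u))/2`. -/
def oddPart (f : ℝ → ℂ) : ℝ → ℂ := fun u ↦ (f u - f (-u)) / 2

/-- `oddPart_continuous` — helper of the x-wuc GEN-11 chain «K1′(ℝ) at the stake» (verbatim from the referee-passed extract `SplitXWucK1R.lean` 70c8eb2af2868881; role: see the module docstring). -/
theorem oddPart_continuous {f : ℝ → ℂ} (hfc : Continuous f) : Continuous (oddPart f) := by
  unfold oddPart; fun_prop

/-- `tfT_oddPart` — helper of the x-wuc GEN-11 chain «K1′(ℝ) at the stake» (verbatim from the referee-passed extract `SplitXWucK1R.lean` 70c8eb2af2868881; role: see the module docstring). -/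
theorem tfT_oddPart (f : ℝ → ℂ) (hfc : Continuous f) (lam κ : ℝ) :
    tfT (oddPart f) lam κ = (tfT f lam κ - tfT (fun u ↦ f (-u)) lam κ) / 2 := by
  have hA : IntegrableOn (fun u : ℝ ↦ f u * (Real.cosh (κ * u) : ℂ) * cexp (I * (lam : ℂ) * u))
      (Icc (-1 : ℝ) 1) := (continuous_integrand hfc lam κ).integrableOn_Icc
  have hfc' : Continuous fun u : ℝ ↦ f (-u) := by fun_prop
  have hB : IntegrableOn (fun u : ℝ ↦ f (-u) * (Real.cosh (κ * u) : ℂ) * cexp (I * (lam : ℂ) * u))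
      (Icc (-1 : ℝ) 1) := (continuous_integrand hfc' lam κ).integrableOn_Icc
  unfold tfT
  rw [← integral_sub hA hB, ← integral_div]
  refine setIntegral_congr_fun measurableSet_Icc fun u _ ↦ ?_
  simp only [oddPart]
  ring

/-- `pairing_oddPart` — helper of the x-wuc GEN-11 chain «K1′(ℝ) at the stake» (verbatim from the referee-passed extract `SplitXWucK1R.lean` 70c8eb2af2868881; role: see the module docstring). -/
theorem pairing_oddPart (f : ℝ → ℂ) (hfc : Continuous f) (κ₀ : ℝ) :
    ∫ u in Icc (-1 : ℝ) 1, 2 * (Real.sinh (κ₀ * u) : ℂ) * oddPart f u =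
      ∫ u in Icc (-1 : ℝ) 1, 2 * (Real.sinh (κ₀ * u) : ℂ) * f u := by
  have hk : Continuous fun u : ℝ ↦ (2 : ℂ) * (Real.sinh (κ₀ * u) : ℂ) := by fun_prop
  have hA : IntegrableOn (fun u : ℝ ↦ 2 * (Real.sinh (κ₀ * u) : ℂ) * f u) (Icc (-1 : ℝ) 1) :=
    (hk.mul hfc).integrableOn_Icc
  have hfc' : Continuous fun u : ℝ ↦ f (-u) := by fun_prop
  have hB : IntegrableOn (fun u : ℝ ↦ 2 * (Real.sinh (κ₀ * u) : ℂ) * f (-u)) (Icc (-1 : ℝ) 1) :=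
    (hk.mul hfc').integrableOn_Icc
  have h1 : (∫ u in Icc (-1 : ℝ) 1, 2 * (Real.sinh (κ₀ * u) : ℂ) * oddPart f u) =
      ((∫ u in Icc (-1 : ℝ) 1, 2 * (Real.sinh (κ₀ * u) : ℂ) * f u) -
        ∫ u in Icc (-1 : ℝ) 1, 2 * (Real.sinh (κ₀ * u) : ℂ) * f (-u)) / 2 := by
    rw [← integral_sub hA hB, ← integral_div]
    refine setIntegral_congr_fun measurableSet_Icc fun u _ ↦ ?_
    simp only [oddPart]
    ring
  rw [h1, pairing_reflect]
  ring

/-- `‖F_{f_odd}(λ,κ)‖ ≤ ‖F_f(λ,κ)‖` for real-valued `f`: `F_{f_odd} = (F − conj F)/2 = i·Im F`. -/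
theorem norm_tfT_oddPart_le {f : ℝ → ℂ} (hf : ∀ u ∈ Icc (-1 : ℝ) 1, (f u).im = 0) (hfc : Continuous f)
    (lam κ : ℝ) : ‖tfT (oddPart f) lam κ‖ ≤ ‖tfT f lam κ‖ := by
  rw [tfT_oddPart f hfc, tfT_reflect, tfT_neg hf]
  set F := tfT f lam κ
  have h : (F - conj F) / 2 = ((F.im : ℝ) : ℂ) * I := by
    rw [Complex.sub_conj]
    push_cast
    ring
  rw [h, norm_mul, Complex.norm_I, mul_one, Complex.norm_real]
  exact Complex.abs_im_le_norm F

end SignConeRung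
end Summit.RiemannHypothesis.RiemannHypothesis.Theorems.Splittings.XWucG8
namespace Summit.RiemannHypothesis.RiemannHypothesis.Theorems.Splittings.XWucG8
open scoped Classical ComplexConjugate
open Set Filter Topology Complex MeasureTheory
namespace SignConeRung
/-- The real part of `f`, as a `ℂ`-valued test function. -/
def reC (f : ℝ → ℂ) : ℝ → ℂ := fun u ↦ ((f u).re : ℂ)

/-- The imaginary part of `f`, as a `ℂ`-valued test function. -/
def imC (f : ℝ → ℂ) : ℝ → ℂ := fun u ↦ ((f u).im : ℂ)

/-- `reC_continuous` — helper of the x-wuc GEN-11 chain «K1′(ℝ) at the stake» (verbatim from the referee-passed extract `SplitXWucK1R.lean` 70c8eb2af2868881; role: see the module docstring). -/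
theorem reC_continuous {f : ℝ → ℂ} (hfc : Continuous f) : Continuous (reC f) := by
  unfold reC; fun_prop

/-- `imC_continuous` — helper of the x-wuc GEN-11 chain «K1′(ℝ) at the stake» (verbatim from the referee-passed extract `SplitXWucK1R.lean` 70c8eb2af2868881; role: see the module docstring). -/
theorem imC_continuous {f : ℝ → ℂ} (hfc : Continuous f) : Continuous (imC f) := by
  unfold imC; fun_prop

/-- `F_f = F_{Re f} + F_{Im f} · i`. -/
theorem tfT_split (f : ℝ → ℂ) (hfc : Continuous f) (lam κ : ℝ) :
    tfT f lam κ = tfT (reC f) lam κ + tfT (imC f) lam κ * I := by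
  have hA : IntegrableOn (fun u : ℝ ↦ reC f u * (Real.cosh (κ * u) : ℂ) * cexp (I * (lam : ℂ) * u))
      (Icc (-1 : ℝ) 1) := (continuous_integrand (reC_continuous hfc) lam κ).integrableOn_Icc
  have hB : IntegrableOn (fun u : ℝ ↦ imC f u * (Real.cosh (κ * u) : ℂ) * cexp (I * (lam : ℂ) * u) * I)
      (Icc (-1 : ℝ) 1) :=
    ((continuous_integrand (imC_continuous hfc) lam κ).mul continuous_const).integrableOn_Icc
  unfold tfT
  rw [← integral_mul_const, ← integral_add hA hB]
  refine setIntegral_congr_fun measurableSet_Icc fun u _ ↦ ?_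
  simp only [reC, imC]
  conv_lhs => rw [← Complex.re_add_im (f u)]
  ring

end SignConeRung
end Summit.RiemannHypothesis.RiemannHypothesis.Theorems.Splittings.XWucG8
open Real Set Filter Topology
namespace Summit.RiemannHypothesis.RiemannHypothesis.Theorems.Splittings.XWucG8.DSLine
end Summit.RiemannHypothesis.RiemannHypothesis.Theorems.Splittings.XWucG8.DSLine
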